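import Summits.QuantumFields.YangMills.Theorems.IR.Negative.TypShellCondFalseFixedMesh
import Summits.QuantumFields.YangMills.Theorems.BalabanLadderIRFrameCells
import Literature.MathematicalPhysics.QuantumFieldTheory.LatticeGaugeShenZhuZhuProofs

/-!
# Crux `IR` (stmt-QuantumFields-19354), slot of record `af-pincer-Uc` (skeleton sha16 b6e69d9662b5b07a):
# FORMAT Uc FORCES BOUNDARY-CONDITION INSENSITIVITY OF THE CENTRE CELL UNIFORMLY OVER ALL EXTERIOR DATA —
# A WILD WIRE KILLS IT; `WildWire` TYPES `stub_onsetUc`'s Uc-SPECIFIC BET (disprove-1 g5, Negative lane, part 1/2)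

WHAT IS PROVED (sorry-free; axioms `propext`, `Classical.choice`, `Quot.sound`).  §0: VERBATIM mirrors of the slot's format
`TypShellCondUKPc` (`pub/ym-beyond/p2-g28-files/line-af-pincer-Uc.reg.lean` :174–223 — `IsFrame`, `TypLocal`, `ClauseI` = the
landed `FixedMesh.ClauseI` (identical text, reused), `ClauseIAll` ((i) AT EVERY CENTRE via the tree's `shiftFrame`), `ClauseIIukp`
((ii) in UKP form: radius-1 exemption `c' ∈ F' ∨ ζ ∈ Typ c'`), `ClauseIII`) and of `stub_onsetUc`'s statement
`OnsetMixingTypicalUKPc` (:266).  §2: `abs_sub_le_of_typShellCondUKPc` — if format Uc holds at `(ρ, β, b, n, ε, δ)` then for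
EVERY frame, EVERY measurable centre-cell event `A`, EVERY finite resampled region `F' ⊇ collarBlock n` (cells at sup-distance
`≤ 2n+2`: window + shell + ONE more collar) and EVERY two exterior data `ζ, ζ'` (frozen, designed, Gibbs-atypical, massless —
anything): `|γ_{F'}(ζ)(A) − γ_{F'}(ζ')(A)| ≤ 2ε + 2·#shell·δ`.  Only (i) at centre `0` and (ii)-UKP are used, NOT the torus
anchor (iii): the radius-1 exemption is discharged by `c' ∈ F'` for every shell cell, so (ii)-UKP bounds each shell cell's
atypicality under `γ_{F'}(ζ)` by `δ` for ARBITRARY `ζ`; DLR consistency (`isSpecification_ymSpecification_of_t2Space`) and (i)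
at `Y = windowCells n` (agreement clause void, test `1_A`) do the rest.  Under the registered format T the argument is NOT
available ((ii_T) reads `ζ` typical on the collar of `F'` — exactly the wild cells; the T analogue needs Gibbs-typical data with
a mass floor, `MassWire`, p500647): this types the owner's separation surface R59-U.  `WildWire` (two arbitrary data polarising
a centre event `≤ 1/3` vs `≥ 2/3` through `γ_{F'}`, `F' ⊇ collarBlock n`, at every mesh `b ≥ 1`, `n ≥ 1`, all large `β`) ⇒
`not_onsetMixingTypicalUKPc_of_wildWire(SU2)`: `stub_onsetUc ⊢ ¬ WildWire r.ρ` (at each large `β` SOME mesh has approximate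
uniqueness of the cell marginal across ALL boundary conditions).  Whether `SU(2)` carries a wild wire is a 4-d lattice
Yang–Mills statement the tree cannot decide: verdict of record for the Uc cut NOT REFUTED (memo
`pub/ym-beyond/ym-19354-disprove-1/NOT-REFUTED.md` §10).  Part 2/2 (`OnsetFormatsUcTransfer`) transfers the T-kills.
Elementary given the tree (Mathlib + landed Theorems∕Literature modules); no named facts as hypotheses; no `sorry`. -/

set_option autoImplicit false

noncomputable section

open Filter Topology MeasureTheory
open Literature.MathematicalPhysics.QuantumFieldTheory Literature.MathematicalPhysics.QuantumLattice
open Literature.Probability.LatticeModels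
open Summit.QuantumFields.YangMills.Cruxes.IR.Tempered (cellEdges windowCells regionEdges)
open Summit.QuantumFields.YangMills.Cruxes.IR.ShellTempered (windowCellsPlus)
open Summit.QuantumFields.YangMills.Cruxes.IR.CellTempered.Engine (shiftFrame)
open Summit.QuantumFields.YangMills.Cruxes.IR.OnsetFormats (shellCount zero_mem_windowCells)
open Summit.QuantumFields.YangMills.Cruxes.IR.FixedMesh (ClauseI sixteen_mul_eps_lt_one)

namespace Summit.QuantumFields.YangMills.Cruxes.IR.OnsetFormatsUc

/-! ## §0 Format Uc — verbatim mirrors of the slot's named clauses (Uc :174–223) and of `stub_onsetUc` (:266) -/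

/-- The unshifted frame (slot :227). -/
theorem shiftFrame_zero (w : Fin 4 → ℤ → ℤ) : shiftFrame w 0 = w := by
  funext i j; simp [shiftFrame]

section Format

variable {G : Type} [Group G] [TopologicalSpace G] [IsTopologicalGroup G] [CompactSpace G]
  [MeasurableSpace G] [BorelSpace G]

/-- mirror of `AfPincerUc.IsFrame` (Uc :177): a mesh-`b` frame, `b ≤ w i (j+1) − w i j ≤ 2b`. -/
def IsFrame (b : ℕ) (w : Fin 4 → ℤ → ℤ) : Prop :=
  ∀ i j, w i j + ((b : ℕ) : ℤ) ≤ w i (j + 1) ∧ w i (j + 1) ≤ w i j + 2 * ((b : ℕ) : ℤ)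

/-- mirror of `AfPincerUc.TypLocal` (Uc :181): every `Typ c` is measurable and read off the cell's own edges. -/
def TypLocal (w : Fin 4 → ℤ → ℤ) (Typ : (Fin 4 → ℤ) → Set (LGConfig 4 G)) : Prop :=
  (∀ c, MeasurableSet (Typ c)) ∧ (∀ c, DependsOn (fun σ : LGConfig 4 G => σ ∈ Typ c) ↑(cellEdges w c))

/-- mirror of `AfPincerUc.ClauseIAll` (Uc :200): clause (i) AT EVERY CENTRE for one family (`ClauseI` = the landed
`FixedMesh.ClauseI`, whose text is the slot's `AfPincerUc.ClauseI` :186–195 verbatim). -/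
def ClauseIAll {N : ℕ} (ρ : G →* Matrix (Fin N) (Fin N) ℂ) (β : ℝ) (w : Fin 4 → ℤ → ℤ) (n : ℕ) (ε : ℝ)
    (Typ : (Fin 4 → ℤ) → Set (LGConfig 4 G)) : Prop :=
  ∀ c₀ : Fin 4 → ℤ, ClauseI ρ β (shiftFrame w c₀) n ε (fun c => Typ (c + c₀))

/-- mirror of `AfPincerUc.ClauseIIukp` (Uc :205): clause (ii) in UKP form — for `F ⊆ F'` and EVERY exterior `ζ` such
that each cell within sup-distance `1` of a charged cell is resampled or typical, `γ_{F'}(ζ){all F atypical} ≤ δ^#F`. -/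
def ClauseIIukp {N : ℕ} (ρ : G →* Matrix (Fin N) (Fin N) ℂ) (β : ℝ) (w : Fin 4 → ℤ → ℤ) (δ : ℝ)
    (Typ : (Fin 4 → ℤ) → Set (LGConfig 4 G)) : Prop :=
  ∀ F F' : Finset (Fin 4 → ℤ), F ⊆ F' → F.Nonempty → ∀ ζ : LGConfig 4 G,
    (∀ c ∈ F, ∀ c' : Fin 4 → ℤ, (∀ i, |c' i - c i| ≤ 1) → c' ∈ F' ∨ ζ ∈ Typ c') →
      (ymSpecification ρ β (regionEdges w F') ζ) {σ : LGConfig 4 G | ∀ c ∈ F, σ ∉ Typ c} ≤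
        ENNReal.ofReal (δ ^ F.card)

/-- mirror of `AfPincerUc.ClauseIII` (Uc :213): the torus anchor (iii_T) verbatim. -/
def ClauseIII {N : ℕ} (ρ : G →* Matrix (Fin N) (Fin N) ℂ) (β : ℝ) (w : Fin 4 → ℤ → ℤ) (b : ℕ) (δ : ℝ)
    (Typ : (Fin 4 → ℤ) → Set (LGConfig 4 G)) : Prop :=
  ∀ S : ℕ, 4 * b ≤ 2 * S + 1 → ∀ F : Finset (Fin 4 → ℤ), F.Nonempty →
    (∀ c ∈ F, ∀ i, -(S : ℤ) ≤ w i (c i) ∧ w i (c i + 1) ≤ (S : ℤ) + 1) →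
      (wilsonMeasure (d := 4) (L := 2 * S + 1) ρ β)
          {V : GaugeConfig 4 (2 * S + 1) G | ∀ c ∈ F, torusLift (2 * S + 1) V ∉ Typ c} ≤
        ENNReal.ofReal (δ ^ F.card)

/-- mirror of `AfPincerUc.TypShellCondUKPc` (Uc :222): per frame ONE family `Typ` with locality, (i) at EVERY
centre, (ii) in UKP form, (iii) verbatim. -/
def TypShellCondUKPc {N : ℕ} (ρ : G →* Matrix (Fin N) (Fin N) ℂ) (β : ℝ) (b n : ℕ) (ε δ : ℝ) : Prop :=
  ∀ w : Fin 4 → ℤ → ℤ, IsFrame b w →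
    ∃ Typ : (Fin 4 → ℤ) → Set (LGConfig 4 G),
      TypLocal w Typ ∧ ClauseIAll ρ β w n ε Typ ∧ ClauseIIukp ρ β w δ Typ ∧ ClauseIII ρ β w b δ Typ

/-- mirror of `AfPincerUc.OnsetMixingTypicalUKPc` (Uc :266) — the stub statement `stub_onsetUc`, verbatim up to the
mirrored `TypShellCondUKPc`. -/
def OnsetMixingTypicalUKPc : Prop :=
  ∀ (G : Type) [Group G] [TopologicalSpace G] [IsTopologicalGroup G] [CompactSpace G],
    IsCompactSimpleLieGroup G → letI : MeasurableSpace G := borel G; haveI : BorelSpace G := ⟨rfl⟩;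
    ∀ r : LatticeRep G, ∃ (n : ℕ) (ε : ℝ), 1 ≤ n ∧ 0 ≤ ε ∧ ε * shellCount n ≤ 3 / 4 ∧
      ∀ δ : ℝ, 0 < δ → ∃ β₂ : ℝ, ∀ β : ℝ, β₂ ≤ β → ∃ b : ℕ, 1 ≤ b ∧ TypShellCondUKPc r.ρ β b n ε δ

/-! ## §2 The Uc-specific content: uniform boundary-condition insensitivity; the wild wire -/

/-- The COLLAR BLOCK: the cells at sup-distance `≤ 2n+2` from the centre (window radius `2n`, shell `2n+1`, one more
collar) — every cell (ii)-UKP's radius-1 exemption can name around a shell cell. -/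
def collarBlock (n : ℕ) : Finset (Fin 4 → ℤ) :=
  Fintype.piFinset fun _ : Fin 4 => Finset.Icc (-(2 * (n : ℤ) + 2)) (2 * (n : ℤ) + 2)

/-- The window lies in the collar block. -/
theorem windowCells_subset_collarBlock (n : ℕ) : windowCells n ⊆ collarBlock n := by
  intro c hc
  rw [collarBlock, Fintype.mem_piFinset]
  intro i
  have h := Finset.mem_Icc.mp (Fintype.mem_piFinset.mp hc i)
  rw [Finset.mem_Icc]
  constructor <;> omega

/-- A cell within sup-distance `1` of a window-or-shell cell lies in the collar block. -/
theorem mem_collarBlock_of_near {n : ℕ} {s c' : Fin 4 → ℤ} (hs : s ∈ windowCellsPlus n)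
    (hc' : ∀ i, |c' i - s i| ≤ 1) : c' ∈ collarBlock n := by
  rw [collarBlock, Fintype.mem_piFinset]
  intro i
  have h1 := Finset.mem_Icc.mp (Fintype.mem_piFinset.mp hs i)
  have h2 := abs_le.mp (hc' i)
  rw [Finset.mem_Icc]
  constructor <;> omega

/-- Regions are monotone in the cell set. -/
theorem regionEdges_mono (w : Fin 4 → ℤ → ℤ) {Y Y' : Finset (Fin 4 → ℤ)} (h : Y ⊆ Y') :
    regionEdges w Y ⊆ regionEdges w Y' :=
  Finset.biUnion_subset_biUnion_of_subset_left (cellEdges w) h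

/-- **Wild wire at one parameter point** `(ρ, β, b, n)`: a frame `w` of mesh `b`, a measurable CENTRE-CELL event `A`
(read off `cellEdges w 0`), a finite resampled region `F' ⊇ collarBlock n` and two ARBITRARY exterior data `ζ₀, ζ₁` (no
typicality, no mass asked) whose `F'`-kernels POLARISE `A`: `γ_{F'}(ζ₀)(A) ≤ 1/3`, `γ_{F'}(ζ₁)(A) ≥ 2/3`. -/
def WildWireAt {N : ℕ} (ρ : G →* Matrix (Fin N) (Fin N) ℂ) (β : ℝ) (b n : ℕ) : Prop :=
  ∃ w : Fin 4 → ℤ → ℤ, IsFrame b w ∧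
    ∃ (A : Set (LGConfig 4 G)) (F' : Finset (Fin 4 → ℤ)) (ζ₀ ζ₁ : LGConfig 4 G),
      MeasurableSet A ∧ DependsOn (fun σ : LGConfig 4 G => σ ∈ A) ↑(cellEdges w 0) ∧ collarBlock n ⊆ F' ∧
      (ymSpecification ρ β (regionEdges w F') ζ₀).real A ≤ 1 / 3 ∧
      2 / 3 ≤ (ymSpecification ρ β (regionEdges w F') ζ₁).real A

/-- **Wild wire** for the Wilson kernels of `ρ` (the typed hypothesis killing `stub_onsetUc` at `(G, ρ)`): one
threshold `β₀` beyond which `WildWireAt ρ β b n` holds at EVERY mesh `b ≥ 1` and every window parameter `n ≥ 1`. -/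
def WildWire {N : ℕ} (ρ : G →* Matrix (Fin N) (Fin N) ℂ) : Prop :=
  ∃ β₀ : ℝ, ∀ β : ℝ, β₀ ≤ β → ∀ b n : ℕ, 1 ≤ b → 1 ≤ n → WildWireAt ρ β b n

/-- **FORMAT Uc FORCES UNIFORM BOUNDARY-CONDITION INSENSITIVITY OF THE CENTRE CELL.**  If `TypShellCondUKPc ρ β b n ε δ`
(`0 ≤ ε`, `0 ≤ δ`), then for every frame `w` of mesh `b`, every measurable centre-cell event `A`, every finite region
`F' ⊇ collarBlock n` and EVERY two exterior data `ζ, ζ'`: `|γ_{F'}(ζ)(A) − γ_{F'}(ζ')(A)| ≤ 2ε + 2·#shell·δ`.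
((ii)-UKP at shell singletons for arbitrary `ζ` + union bound; DLR consistency `γ_{F'} γ_{window} = γ_{F'}`; (i) at
`Y = windowCells n` with the test `1_A` against one fixed good datum.  Uses (i) at centre `0` and (ii) only.) -/
theorem abs_sub_le_of_typShellCondUKPc [T2Space G] [SecondCountableTopology G] {N : ℕ}
    {ρ : G →* Matrix (Fin N) (Fin N) ℂ} (hρ : Continuous ρ) {β : ℝ} {b n : ℕ} {ε δ : ℝ}
    (hT : TypShellCondUKPc ρ β b n ε δ) (hε : 0 ≤ ε) (hδ : 0 ≤ δ) {w : Fin 4 → ℤ → ℤ} (hw : IsFrame b w)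
    {A : Set (LGConfig 4 G)} (hA : MeasurableSet A)
    (hAdep : DependsOn (fun σ : LGConfig 4 G => σ ∈ A) ↑(cellEdges w 0))
    {F' : Finset (Fin 4 → ℤ)} (hF' : collarBlock n ⊆ F') (ζ ζ' : LGConfig 4 G) :
    |(ymSpecification ρ β (regionEdges w F') ζ).real A - (ymSpecification ρ β (regionEdges w F') ζ').real A| ≤
      2 * ε + 2 * (((windowCellsPlus n \ windowCells n).card : ℝ) * δ) := by
  have hγ := isSpecification_ymSpecification_of_t2Space (d := 4) ρ hρ β
  have hP : ∀ (Λ : Finset (Literature.MathematicalPhysics.QuantumLattice.ZdEdge 4)) (η : LGConfig 4 G),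
      IsProbabilityMeasure (ymSpecification (d := 4) ρ β Λ η) := hγ.isProbability
  have h01 : ∀ (Λ : Finset (Literature.MathematicalPhysics.QuantumLattice.ZdEdge 4)) (η : LGConfig 4 G)
      (s : Set (LGConfig 4 G)),
      0 ≤ (ymSpecification ρ β Λ η).real s ∧ (ymSpecification ρ β Λ η).real s ≤ 1 := by
    intro Λ η s
    haveI := hP Λ η
    exact ⟨measureReal_nonneg, measureReal_le_one⟩
  have hm0 : 0 ≤ ((windowCellsPlus n \ windowCells n).card : ℝ) * δ := mul_nonneg (Nat.cast_nonneg _) hδ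
  -- the trivial branch: the bound is at least `1`
  by_cases hmδ : 1 ≤ 2 * (((windowCellsPlus n \ windowCells n).card : ℝ) * δ)
  · obtain ⟨h0, h1⟩ := h01 (regionEdges w F') ζ A
    obtain ⟨h0', h1'⟩ := h01 (regionEdges w F') ζ' A
    rw [abs_le]
    constructor <;> linarith
  push Not at hmδ
  -- the class of the format at the frame `w`; clause (i) at centre `0`
  obtain ⟨Typ, ⟨hmeas, -⟩, hi, hii, -⟩ := hT w hw
  have hi0 : ClauseI ρ β w n ε Typ := by
    have h := hi 0
    have hT0 : (fun c : Fin 4 → ℤ => Typ (c + 0)) = Typ := by funext c; rw [add_zero]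
    rw [shiftFrame_zero, hT0] at h
    exact h
  -- (ii)-UKP at the shell singletons, for EVERY datum
  have hcell : ∀ η : LGConfig 4 G, ∀ s ∈ windowCellsPlus n \ windowCells n,
      ymSpecification ρ β (regionEdges w F') η {σ : LGConfig 4 G | σ ∉ Typ s} ≤ ENNReal.ofReal δ := by
    intro η s hs
    have hsP : s ∈ windowCellsPlus n := (Finset.mem_sdiff.mp hs).1
    have hsF' : s ∈ F' := hF' (mem_collarBlock_of_near hsP fun i => by simp)
    have h := hii {s} F' (Finset.singleton_subset_iff.mpr hsF') (Finset.singleton_nonempty s) η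
      (fun c hc c' hc' => by
        rw [Finset.mem_singleton] at hc
        subst hc
        exact Or.inl (hF' (mem_collarBlock_of_near hsP hc')))
    simpa only [Finset.mem_singleton, forall_eq, Finset.card_singleton, pow_one] using h
  -- the bad event: some shell cell atypical; union bound under every kernel
  set Bad : Set (LGConfig 4 G) := ⋃ c ∈ windowCellsPlus n \ windowCells n, {σ | σ ∉ Typ c} with hBad
  have hBadm : MeasurableSet Bad := Finset.measurableSet_biUnion _ fun c _ => (hmeas c).compl
  have hBad_le : ∀ η : LGConfig 4 G, ymSpecification ρ β (regionEdges w F') η Bad ≤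
      ENNReal.ofReal (((windowCellsPlus n \ windowCells n).card : ℝ) * δ) := by
    intro η
    calc ymSpecification ρ β (regionEdges w F') η Bad
        ≤ ∑ c ∈ windowCellsPlus n \ windowCells n,
            ymSpecification ρ β (regionEdges w F') η {σ | σ ∉ Typ c} := measure_biUnion_finset_le _ _
      _ ≤ (windowCellsPlus n \ windowCells n).card • ENNReal.ofReal δ :=
          Finset.sum_le_card_nsmul _ _ _ (hcell η)
      _ = ENNReal.ofReal (((windowCellsPlus n \ windowCells n).card : ℝ) * δ) := by
          rw [nsmul_eq_mul, ENNReal.ofReal_mul (Nat.cast_nonneg _), ENNReal.ofReal_natCast]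
  have hBad_real : ∀ η : LGConfig 4 G, (ymSpecification ρ β (regionEdges w F') η).real Bad ≤
      ((windowCellsPlus n \ windowCells n).card : ℝ) * δ := by
    intro η
    rw [measureReal_def]
    exact (ENNReal.toReal_mono ENNReal.ofReal_ne_top (hBad_le η)).trans_eq (ENNReal.toReal_ofReal hm0)
  have hgood : ∀ σ : LGConfig 4 G, σ ∉ Bad → ∀ c ∈ windowCellsPlus n, c ∉ windowCells n → σ ∈ Typ c := by
    intro σ hσ c hcP hcW
    by_contra hnot
    exact hσ (Set.mem_biUnion (Finset.mem_sdiff.mpr ⟨hcP, hcW⟩) hnot)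
  -- one good datum (the bad event has mass `< 1/2` under `γ_{F'}(ζ)`)
  obtain ⟨σs, hσs⟩ : ∃ σ : LGConfig 4 G, σ ∉ Bad := by
    by_contra hno
    push Not at hno
    have huniv : Bad = Set.univ := Set.eq_univ_of_forall hno
    haveI := hP (regionEdges w F') ζ
    have h1 : (ymSpecification ρ β (regionEdges w F') ζ).real Bad = 1 := by rw [huniv, probReal_univ]
    linarith [hBad_real ζ]
  -- the centre-cell test `1_A` and clause (i) at `Y = windowCells n`
  have hf_meas : Measurable (A.indicator (1 : LGConfig 4 G → ℝ)) := measurable_one.indicator hA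
  have hf_cyl : IsCylinder (A.indicator (1 : LGConfig 4 G → ℝ)) (cellEdges w 0) := by
    intro σ σ' hagree
    have h : (σ ∈ A) = (σ' ∈ A) := hAdep hagree
    by_cases hσ : σ ∈ A
    · have hσ' : σ' ∈ A := h ▸ hσ
      rw [Set.indicator_of_mem hσ, Set.indicator_of_mem hσ', Pi.one_apply, Pi.one_apply]
    · have hσ' : σ' ∉ A := fun h' => hσ (h ▸ h')
      rw [Set.indicator_of_notMem hσ, Set.indicator_of_notMem hσ']
  have hf01 : ∀ U : LGConfig 4 G,
      0 ≤ A.indicator (1 : LGConfig 4 G → ℝ) U ∧ A.indicator (1 : LGConfig 4 G → ℝ) U ≤ 1 := by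
    intro U
    by_cases hU : U ∈ A
    · rw [Set.indicator_of_mem hU, Pi.one_apply]
      norm_num
    · rw [Set.indicator_of_notMem hU]
      norm_num
  have hI : ∀ σ : LGConfig 4 G, σ ∉ Bad →
      |(ymSpecification ρ β (regionEdges w (windowCells n)) σ).real A -
        (ymSpecification ρ β (regionEdges w (windowCells n)) σs).real A| ≤ ε := by
    intro σ hσ
    have h := hi0 (windowCells n) subset_rfl (zero_mem_windowCells n) σ σs
      (fun c hc hcY => ⟨hgood σ hσ c hc hcY, hgood σs hσs c hc hcY⟩)
      (fun c _ hcY hcW => absurd hcW hcY) _ hf_cyl hf_meas hf01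
    rwa [integral_indicator_one hA, integral_indicator_one hA] at h
  -- pointwise: `|γ_W(σ)(A) − γ_W(σs)(A)| ≤ ε + 1_Bad(σ)`
  have hpt : ∀ σ : LGConfig 4 G,
      |(ymSpecification ρ β (regionEdges w (windowCells n)) σ).real A -
        (ymSpecification ρ β (regionEdges w (windowCells n)) σs).real A| ≤
        ε + Bad.indicator (1 : LGConfig 4 G → ℝ) σ := by
    intro σ
    by_cases hσ : σ ∈ Bad
    · rw [Set.indicator_of_mem hσ, Pi.one_apply]
      obtain ⟨h0, h1⟩ := h01 (regionEdges w (windowCells n)) σ A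
      obtain ⟨h0', h1'⟩ := h01 (regionEdges w (windowCells n)) σs A
      rw [abs_le]
      constructor <;> linarith
    · rw [Set.indicator_of_notMem hσ, add_zero]
      exact hI σ hσ
  -- DLR consistency: `γ_{F'}(η)(A) = ∫ γ_W(σ)(A) dγ_{F'}(η)(σ)`
  have hWR : regionEdges w (windowCells n) ⊆ regionEdges w F' :=
    regionEdges_mono w ((windowCells_subset_collarBlock n).trans hF')
  have hg_meas' : Measurable fun σ : LGConfig 4 G => ymSpecification ρ β (regionEdges w (windowCells n)) σ A :=
    hγ.measurable_coe (regionEdges w (windowCells n)) hA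
  have hg_meas : Measurable fun σ : LGConfig 4 G =>
      (ymSpecification ρ β (regionEdges w (windowCells n)) σ).real A := by
    simp only [measureReal_def]
    exact hg_meas'.ennreal_toReal
  have hrepr : ∀ η : LGConfig 4 G, (ymSpecification ρ β (regionEdges w F') η).real A =
      ∫ σ, (ymSpecification ρ β (regionEdges w (windowCells n)) σ).real A
        ∂(ymSpecification ρ β (regionEdges w F') η) := by
    intro η
    simp only [measureReal_def]
    rw [← hγ.consistent hWR η A hA, integral_toReal hg_meas'.aemeasurable]
    refine ae_of_all _ fun σ => ?_
    haveI := hP (regionEdges w (windowCells n)) σ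
    exact prob_le_one.trans_lt ENNReal.one_lt_top
  -- integrate the pointwise bound under `γ_{F'}(η)`
  have hkey : ∀ η : LGConfig 4 G,
      |(ymSpecification ρ β (regionEdges w F') η).real A -
        (ymSpecification ρ β (regionEdges w (windowCells n)) σs).real A| ≤
        ε + ((windowCellsPlus n \ windowCells n).card : ℝ) * δ := by
    intro η
    set μ := ymSpecification ρ β (regionEdges w F') η with hμ
    haveI : IsProbabilityMeasure μ := hP _ η
    have hg_int : Integrable
        (fun σ : LGConfig 4 G => (ymSpecification ρ β (regionEdges w (windowCells n)) σ).real A) μ :=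
      (integrable_const (1 : ℝ)).mono' hg_meas.aestronglyMeasurable
        (ae_of_all _ fun σ => by
          obtain ⟨h0, h1⟩ := h01 (regionEdges w (windowCells n)) σ A
          rw [Real.norm_eq_abs, abs_of_nonneg h0]
          exact h1)
    have hind : Integrable (fun σ : LGConfig 4 G => Bad.indicator (1 : LGConfig 4 G → ℝ) σ) μ :=
      (integrable_const (1 : ℝ)).indicator hBadm
    have hsub : μ.real A - (ymSpecification ρ β (regionEdges w (windowCells n)) σs).real A =
        ∫ σ, ((ymSpecification ρ β (regionEdges w (windowCells n)) σ).real A -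
          (ymSpecification ρ β (regionEdges w (windowCells n)) σs).real A) ∂μ := by
      rw [integral_sub hg_int (integrable_const _), integral_const, probReal_univ, one_smul, hrepr η]
    calc |μ.real A - (ymSpecification ρ β (regionEdges w (windowCells n)) σs).real A|
        = |∫ σ, ((ymSpecification ρ β (regionEdges w (windowCells n)) σ).real A -
            (ymSpecification ρ β (regionEdges w (windowCells n)) σs).real A) ∂μ| := by rw [hsub]
      _ ≤ ∫ σ, |(ymSpecification ρ β (regionEdges w (windowCells n)) σ).real A -
            (ymSpecification ρ β (regionEdges w (windowCells n)) σs).real A| ∂μ :=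
          abs_integral_le_integral_abs
      _ ≤ ∫ σ, (ε + Bad.indicator (1 : LGConfig 4 G → ℝ) σ) ∂μ :=
          integral_mono_of_nonneg (ae_of_all _ fun σ => abs_nonneg _) ((integrable_const ε).add hind)
            (ae_of_all _ hpt)
      _ = ε + μ.real Bad := by
          rw [integral_add (integrable_const ε) hind, integral_const, probReal_univ, one_smul,
            integral_indicator_one hBadm]
      _ ≤ ε + ((windowCellsPlus n \ windowCells n).card : ℝ) * δ := by linarith [hBad_real η]
  -- triangle inequality through the good datum
  have h1 := hkey ζ
  have h2 := hkey ζ'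
  rw [abs_sub_comm] at h2
  calc |(ymSpecification ρ β (regionEdges w F') ζ).real A - (ymSpecification ρ β (regionEdges w F') ζ').real A|
      ≤ |(ymSpecification ρ β (regionEdges w F') ζ).real A -
          (ymSpecification ρ β (regionEdges w (windowCells n)) σs).real A| +
        |(ymSpecification ρ β (regionEdges w (windowCells n)) σs).real A -
          (ymSpecification ρ β (regionEdges w F') ζ').real A| := abs_sub_le _ _ _
    _ ≤ 2 * ε + 2 * (((windowCellsPlus n \ windowCells n).card : ℝ) * δ) := by linarith

/-- **A wild wire kills format Uc at every small budget** (`0 ≤ ε`, `0 ≤ δ`, `2ε + 2·#shell·δ < 1/3`): the two wild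
data polarise the centre event by `≥ 1/3`, against the uniform insensitivity bound. -/
theorem not_typShellCondUKPc_of_wildWireAt [T2Space G] [SecondCountableTopology G] {N : ℕ}
    {ρ : G →* Matrix (Fin N) (Fin N) ℂ} (hρ : Continuous ρ) {β : ℝ} {b n : ℕ} {ε δ : ℝ}
    (hW : WildWireAt ρ β b n) (hε : 0 ≤ ε) (hδ : 0 ≤ δ)
    (h : 2 * ε + 2 * (((windowCellsPlus n \ windowCells n).card : ℝ) * δ) < 1 / 3) :
    ¬ TypShellCondUKPc ρ β b n ε δ := by
  intro hT
  obtain ⟨w, hw, A, F', ζ₀, ζ₁, hA, hAdep, hF', h0, h1⟩ := hW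
  have hb := abs_sub_le_of_typShellCondUKPc hρ hT hε hδ hw hA hAdep hF' ζ₁ ζ₀
  rw [abs_le] at hb
  linarith [hb.2]

/-- **`WildWire r.ρ` refutes `stub_onsetUc`'s conclusion at `(G, r)`**: for every admissible `(n, ε)`
(`ε·M(n) ≤ 3/4`, so `16 ε < 1`), at the budget `δ = 1/(16(#shell + 1))` NO mesh carries format Uc at large `β`
(`2ε + 2·#shell·δ < 1/8 + 1/8 < 1/3`).  No `NT`, no unit map, no simplicity, no torus anchor. -/
theorem onsetMixingTypicalUKPcAt_false_of_wildWire [T2Space G] [SecondCountableTopology G] (r : LatticeRep G)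
    (hW : WildWire r.ρ) :
    ¬ ∃ (n : ℕ) (ε : ℝ), 1 ≤ n ∧ 0 ≤ ε ∧ ε * shellCount n ≤ 3 / 4 ∧
        ∀ δ : ℝ, 0 < δ → ∃ β₂ : ℝ, ∀ β : ℝ, β₂ ≤ β → ∃ b : ℕ, 1 ≤ b ∧ TypShellCondUKPc r.ρ β b n ε δ := by
  rintro ⟨n, ε, hn, hε0, hM, hIδ⟩
  obtain ⟨β₀, hwire⟩ := hW
  have h16 : 16 * ε < 1 := sixteen_mul_eps_lt_one (by linarith) hε0
  set k : ℝ := ((windowCellsPlus n \ windowCells n).card : ℝ) with hk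
  have hk0 : 0 ≤ k := Nat.cast_nonneg _
  have hδ0 : 0 < 1 / (16 * (k + 1)) := by positivity
  obtain ⟨β₂, hon⟩ := hIδ _ hδ0
  obtain ⟨b, hb, hT⟩ := hon (max β₀ β₂) (le_max_right _ _)
  have hkk : k / (k + 1) < 1 := (div_lt_one (by positivity)).mpr (by linarith)
  have h2 : 16 * (k * (1 / (16 * (k + 1)))) < 1 := by
    rw [mul_one_div, ← mul_div_assoc, mul_div_mul_left k (k + 1) (by norm_num : (16 : ℝ) ≠ 0)]
    exact hkk
  have hlt : 2 * ε + 2 * (k * (1 / (16 * (k + 1)))) < 1 / 3 := by linarith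
  exact not_typShellCondUKPc_of_wildWireAt r.continuous (hwire _ (le_max_left _ _) b n hb hn) hε0 hδ0.le hlt hT

end Format

/-- **`WildWire` for ONE lattice representation of ONE compact simple `G` refutes `stub_onsetUc`'s statement
`OnsetMixingTypicalUKPc`.**  (Hausdorff and second countability of `G` come from the faithful representation `r`.) -/
theorem not_onsetMixingTypicalUKPc_of_wildWire (G : Type) [Group G] [TopologicalSpace G] [IsTopologicalGroup G]
    [CompactSpace G] (hG : IsCompactSimpleLieGroup G)
    (hW : letI : MeasurableSpace G := borel G; haveI : BorelSpace G := ⟨rfl⟩;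
      ∃ r : LatticeRep G, WildWire r.ρ) : ¬ OnsetMixingTypicalUKPc := by
  intro hI
  letI : MeasurableSpace G := borel G
  haveI : BorelSpace G := ⟨rfl⟩
  obtain ⟨r, hWr⟩ := hW
  haveI : T2Space G := T2Space.of_injective_continuous r.injective r.continuous
  haveI : SecondCountableTopology G :=
    (r.continuous.isClosedEmbedding r.injective).isEmbedding.secondCountableTopology
  exact onsetMixingTypicalUKPcAt_false_of_wildWire r hWr (hI G hG r)

/-- `SU(2)` instance: a wild wire for any one lattice representation of `SU(2)` refutes `OnsetMixingTypicalUKPc`.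
This TYPES `stub_onsetUc`'s Uc-specific bet: `¬ WildWire r.ρ` for every `r` of every compact simple `G` — at each
large `β` SOME mesh admits no boundary-condition polarisation `≥ 1/3` of any centre-cell event through any finite
region containing the `(2n+2)`-collar block. -/
theorem not_onsetMixingTypicalUKPc_of_wildWireSU2
    (hW : letI : MeasurableSpace (Matrix.specialUnitaryGroup (Fin 2) ℂ) :=
        borel (Matrix.specialUnitaryGroup (Fin 2) ℂ);
      haveI : BorelSpace (Matrix.specialUnitaryGroup (Fin 2) ℂ) := ⟨rfl⟩;
      ∃ r : LatticeRep (Matrix.specialUnitaryGroup (Fin 2) ℂ), WildWire r.ρ) : ¬ OnsetMixingTypicalUKPc :=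
  not_onsetMixingTypicalUKPc_of_wildWire _
    (isCompactSimpleLieGroup_specialUnitaryGroup isSimpleCompactGroup_specialUnitaryGroup_holds le_rfl) hW

end Summit.QuantumFields.YangMills.Cruxes.IR.OnsetFormatsUc

end
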